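import Literature.NumberTheory.QuadraticFields.RingClassGroup
import Literature.NumberTheory.Automorphic.QuadraticOrderUnits
import HarnessLib

/-!
# Units of an imaginary quadratic field and of its order `ℤ + f𝓞 K`: `#𝓞 Kˣ ∈ {2, 4, 6}`, `#𝒪ˣ = 2`

Topic `NumberTheory/QuadraticFields`, namespace `Literature.NumberTheory.QuadraticFields.RingClass`
(continuing `RingClassGroup.lean`: the norm form `nm`, conjugation `cj` on an integral basis `(1, ω)`,
`ω² = m + tω`). Everything here is PROVED (theorems only).

For an imaginary quadratic field (`d_K = t² + 4m < 0`):

* `isUnit_iff_nm_eq_one` — `x ∈ 𝓞 K` is a unit iff `N(x) = 1` (the norm form is positive definite);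
* `card_units_eq` — **`#𝓞 Kˣ = 6, 4, 2`** according as `d_K = −3, −4, < −4` (Cox, §7.A; the tree's
  Diophantine lemmas `Brandt.solutions_of_*` for `u² + tuv + nv² = 1`);
* `card_orderUnits_eq_two` — **`#𝒪ˣ = 2`** for the order `𝒪 = ℤ + f𝓞 K`, `f ≥ 2`: the units of `𝓞 K`
  congruent to an integer modulo `f𝓞 K` are `±1` (the `w(f² d_K) = 2` of Cox's Thm. 7.24).

## References

* D. A. Cox, *Primes of the form x² + ny²*, 2nd ed., Wiley (2013), §7.A (units of imaginary quadratic
  orders) and §7.D Thm. 7.24 (the unit index `[𝒪_K^* : 𝒪^*]`). [cite: Cox2013, §7.D Thm. 7.24]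
-/

noncomputable section

open scoped nonZeroDivisors
open Module NumberField
open Literature.NumberTheory.QuadraticFields.Quadratic
open Literature.NumberTheory.Automorphic.Brandt

namespace Literature.NumberTheory.QuadraticFields.RingClass

variable {K : Type*} [Field K] [NumberField K]
variable (b : Basis (Fin 2) ℤ (𝓞 K)) (hb : b 0 = 1) {t m : ℤ}
  (hω : b 1 * b 1 = (m : 𝓞 K) + (t : 𝓞 K) * b 1)

/-! ### Units and the norm form -/

omit [NumberField K] in
include hb in
/-- `N(1) = 1`. [cite: Cox2013, §7.A (7.1)] -/
theorem nm_one : nm b (t := t) (m := m) 1 = 1 := by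
  have h0 : b.repr (1 : 𝓞 K) 0 = 1 := by
    have := repr_intCast_add_intCast_mul_zero b hb 1 0; simpa using this
  have h1 : b.repr (1 : 𝓞 K) 1 = 0 := by
    have := repr_intCast_add_intCast_mul_one b hb 1 0; simpa using this
  rw [nm, h0, h1]; ring

omit [NumberField K] in
/-- The norm form is positive definite when `t² + 4m < 0`: `4N(x) = (2x₀ + t x₁)² − (t² + 4m) x₁²`.
[cite: Cox2013, §2.A (2.3) (positive definite forms)] -/
theorem nm_pos (hneg : t ^ 2 + 4 * m < 0) {x : 𝓞 K} (hx : x ≠ 0) : 0 < nm b (t := t) (m := m) x := by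
  rw [nm]
  set u := b.repr x 0
  set v := b.repr x 1
  have huv : u ≠ 0 ∨ v ≠ 0 := by
    by_contra h
    push Not at h
    apply hx
    rw [← b.linearCombination_repr x]
    have : b.repr x = 0 := by
      ext i; fin_cases i
      · exact h.1
      · exact h.2
    rw [this, map_zero]
  have h4 : 4 * (u ^ 2 + t * u * v - m * v ^ 2) = (2 * u + t * v) ^ 2 + (-(t ^ 2 + 4 * m)) * v ^ 2 := by ring
  rcases huv with hu | hv
  · by_cases hv : v = 0
    · rw [hv]; nlinarith [sq_pos_of_ne_zero hu]
    · nlinarith [sq_nonneg (2 * u + t * v), sq_pos_of_ne_zero hv]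
  · nlinarith [sq_nonneg (2 * u + t * v), sq_pos_of_ne_zero hv]

include hb hω in
/-- **`x` is a unit of `𝓞 K` iff `N(x) = 1`** (imaginary quadratic case). [cite: Cox2013, §7.A (units of an order)] -/
theorem isUnit_iff_nm_eq_one (hneg : t ^ 2 + 4 * m < 0) (x : 𝓞 K) :
    IsUnit x ↔ nm b (t := t) (m := m) x = 1 := by
  constructor
  · rintro ⟨u, rfl⟩
    have h1 : nm b (t := t) (m := m) (u : 𝓞 K) * nm b (t := t) (m := m) ((u⁻¹ : (𝓞 K)ˣ) : 𝓞 K) = 1 := by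
      rw [← nm_mul b hb hω, Units.mul_inv, nm_one b hb]
    have hpos := nm_pos b hneg (m := m) (Units.ne_zero u)
    have hpos' := nm_pos b hneg (m := m) (Units.ne_zero u⁻¹)
    nlinarith
  · intro h
    refine IsUnit.of_mul_eq_one (cj b (t := t) x) ?_
    rw [mul_cj b hb hω (m := m), h, Int.cast_one]

include hb hω in
/-- **The units of `𝓞 K` correspond to the solutions of `u² + tuv − mv² = 1`.** [cite: Cox2013, §7.A (units of an order)] -/
theorem card_units_eq_card_solutions (hneg : t ^ 2 + 4 * m < 0) :
    Nat.card (𝓞 K)ˣ = Nat.card {uv : ℤ × ℤ // uv.1 ^ 2 + t * uv.1 * uv.2 + (-m) * uv.2 ^ 2 = 1} := by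
  classical
  refine Nat.card_congr
    { toFun := fun ε => ⟨(b.repr (ε : 𝓞 K) 0, b.repr (ε : 𝓞 K) 1), by
        have := (isUnit_iff_nm_eq_one b hb hω hneg (ε : 𝓞 K)).1 (Units.isUnit ε)
        rw [nm] at this; linear_combination this⟩
      invFun := fun uv => ((isUnit_iff_nm_eq_one b hb hω hneg
          ((uv.1.1 : 𝓞 K) + (uv.1.2 : 𝓞 K) * b 1)).2 (by
        rw [nm, repr_intCast_add_intCast_mul_zero b hb, repr_intCast_add_intCast_mul_one b hb]
        linear_combination uv.2)).unit
      left_inv := fun ε => by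
        apply Units.ext
        rw [IsUnit.unit_spec]
        exact (eq_repr_add_repr_mul_of_basis b hb (ε : 𝓞 K)).symm
      right_inv := fun uv => by
        apply Subtype.ext
        simp only [IsUnit.unit_spec]
        rw [repr_intCast_add_intCast_mul_zero b hb, repr_intCast_add_intCast_mul_one b hb] }

include hb hω in
/-- **`#𝓞 Kˣ = 6, 4, 2`** according as `d_K = t² + 4m` is `−3`, `−4`, or `< −4`.
[cite: Cox2013, §7.A (units of imaginary quadratic orders) and §7.D Thm. 7.24] -/
theorem card_units_eq (hneg : t ^ 2 + 4 * m < 0) :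
    Nat.card (𝓞 K)ˣ = if t ^ 2 + 4 * m = -3 then 6 else if t ^ 2 + 4 * m = -4 then 4 else 2 := by
  rw [card_units_eq_card_solutions b hb hω hneg]
  have hΔ : t ^ 2 - 4 * (-m) = t ^ 2 + 4 * m := by ring
  rcases Int.even_or_odd t with ⟨k, hk⟩ | ⟨k, hk⟩
  · have hk' : t = 2 * k := by rw [hk]; ring
    have hdvd : 4 ∣ t ^ 2 + 4 * m := ⟨k ^ 2 + m, by rw [hk']; ring⟩
    by_cases h4 : t ^ 2 + 4 * m = -4
    · rw [if_neg (by omega), if_pos h4,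
        card_subtype_eq_of_iff (fun uv => solutions_of_eq_neg_four (n := -m) hk' (by rw [hΔ, h4]))]
      rw [Finset.card_insert_of_notMem (by simp), Finset.card_insert_of_notMem (by simp),
        Finset.card_insert_of_notMem (by simp), Finset.card_singleton]
    · have hlt : t ^ 2 - 4 * (-m) < -4 := by rw [hΔ]; omega
      rw [if_neg (by omega), if_neg h4, card_subtype_eq_of_iff (fun uv => solutions_of_lt hlt)]
      rw [Finset.card_insert_of_notMem (by simp), Finset.card_singleton]
  · have hk' : t = 2 * k + 1 := hk
    have hdvd : 4 ∣ t ^ 2 + 4 * m - 1 := ⟨k ^ 2 + k + m, by rw [hk']; ring⟩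
    by_cases h3 : t ^ 2 + 4 * m = -3
    · rw [if_pos h3, card_subtype_eq_of_iff (fun uv => solutions_of_eq_neg_three (n := -m) hk' (by rw [hΔ, h3]))]
      rw [Finset.card_insert_of_notMem (by simp), Finset.card_insert_of_notMem (by simp),
        Finset.card_insert_of_notMem (by simp; omega), Finset.card_insert_of_notMem (by simp),
        Finset.card_insert_of_notMem (by simp), Finset.card_singleton]
    · have hlt : t ^ 2 - 4 * (-m) < -4 := by rw [hΔ]; omega
      rw [if_neg h3, if_neg (by omega), card_subtype_eq_of_iff (fun uv => solutions_of_lt hlt)]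
      rw [Finset.card_insert_of_notMem (by simp), Finset.card_singleton]

/-! ### The units of the order `ℤ + f 𝓞 K` -/

include hb hω in
/-- **`𝒪ˣ = {±1}` for `𝒪 = ℤ + f𝓞 K`, `f ≥ 2`**: a unit `ε = u + vω ≡ n (mod f𝓞 K)` has `f ∣ v`, and
`4 = 4N(ε) = (2u + tv)² + |d_K| v²` with `|d_K| ≥ 3` forces `v = 0`. [cite: Cox2013, §7.D Thm. 7.24 (𝒪* = {±1})] -/
theorem units_sub_intCast_mem_iff (hneg : t ^ 2 + 4 * m < 0) {f : ℕ} (hf : 2 ≤ f) (ε : (𝓞 K)ˣ) :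
    (∃ n : ℤ, IsCoprime n (f : ℤ) ∧ (ε : 𝓞 K) - n ∈ Ideal.span {(f : 𝓞 K)}) ↔ ε = 1 ∨ ε = -1 := by
  constructor
  · rintro ⟨n, -, hn⟩
    have h1 := (isUnit_iff_nm_eq_one b hb hω hneg (ε : 𝓞 K)).1 (Units.isUnit ε)
    have hv := dvd_repr_of_mem_span b hn 1
    rw [map_sub, Finsupp.sub_apply] at hv
    have hn1 : b.repr (n : 𝓞 K) 1 = 0 := by
      have := repr_intCast_add_intCast_mul_one b hb n 0; simpa using this
    rw [hn1, sub_zero] at hv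
    obtain ⟨c, hc⟩ := hv
    rw [nm] at h1
    set u := b.repr (ε : 𝓞 K) 0 with hu
    set v := b.repr (ε : 𝓞 K) 1 with hv'
    have hd3 : t ^ 2 + 4 * m ≤ -3 := by
      rcases Int.even_or_odd t with ⟨k, hk⟩ | ⟨k, hk⟩
      · have : t ^ 2 + 4 * m = 4 * (k ^ 2 + m) := by rw [hk]; ring
        omega
      · have : t ^ 2 + 4 * m = 4 * (k ^ 2 + k + m) + 1 := by rw [hk]; ring
        omega
    have hv0 : v = 0 := by
      by_contra hv0
      have hc0 : c ≠ 0 := by rintro rfl; simp at hc; exact hv0 hc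
      have hc2 : 1 ≤ c ^ 2 := by nlinarith [sq_pos_of_ne_zero hc0]
      have hf2 : (4 : ℤ) ≤ (f : ℤ) ^ 2 := by nlinarith
      have hfc : (4 : ℤ) ≤ ((f : ℤ) * c) ^ 2 := by rw [mul_pow]; nlinarith
      have h4 : 4 = (2 * u + t * v) ^ 2 + (-(t ^ 2 + 4 * m)) * v ^ 2 := by linear_combination -4 * h1
      rw [hc] at h4
      have h12 : (12 : ℤ) ≤ (-(t ^ 2 + 4 * m)) * ((f : ℤ) * c) ^ 2 := by nlinarith
      nlinarith [sq_nonneg (2 * u + t * (↑f * c))]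
    have hu1 : u ^ 2 = 1 := by rw [hv0] at h1; linear_combination h1
    have hε : (ε : 𝓞 K) = (u : 𝓞 K) := by
      rw [eq_repr_add_repr_mul_of_basis b hb (ε : 𝓞 K), ← hu, ← hv', hv0]; simp
    rcases (int_sq_eq_one_iff u).1 hu1 with h | h
    · left; apply Units.ext; rw [hε, h]; simp
    · right; apply Units.ext; rw [hε, h]; simp
  · rintro (rfl | rfl)
    · exact ⟨1, isCoprime_one_left, by simp⟩
    · exact ⟨-1, isCoprime_one_left.neg_left, by simp⟩

include hb hω in
/-- **`#𝒪ˣ = 2`** for `𝒪 = ℤ + f𝓞 K`, `f ≥ 2` (the `w(f² d_K)` of Cox's Thm. 7.24). [cite: Cox2013, §7.D Thm. 7.24] -/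
theorem card_orderUnits_eq_two (hneg : t ^ 2 + 4 * m < 0) {f : ℕ} (hf : 2 ≤ f) :
    Nat.card {ε : (𝓞 K)ˣ // ∃ n : ℤ, IsCoprime n (f : ℤ) ∧ (ε : 𝓞 K) - n ∈ Ideal.span {(f : 𝓞 K)}} = 2 := by
  classical
  have hset : {ε : (𝓞 K)ˣ // ∃ n : ℤ, IsCoprime n (f : ℤ) ∧ (ε : 𝓞 K) - n ∈ Ideal.span {(f : 𝓞 K)}} =
      ↥(({1, -1} : Finset (𝓞 K)ˣ) : Set (𝓞 K)ˣ) := by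
    congr 1; ext ε
    rw [units_sub_intCast_mem_iff b hb hω hneg hf]
    simp
  rw [hset, Nat.card_coe_set_eq, Set.ncard_coe_finset, Finset.card_insert_of_notMem, Finset.card_singleton]
  rw [Finset.mem_singleton]
  intro h
  have h2 : ((1 : (𝓞 K)ˣ) : 𝓞 K) = ((-1 : (𝓞 K)ˣ) : 𝓞 K) := congrArg (fun e : (𝓞 K)ˣ => (e : 𝓞 K)) h
  have : (2 : 𝓞 K) = 0 := by
    simp only [Units.val_one, Units.val_neg] at h2
    linear_combination h2
  exact two_ne_zero this

end Literature.NumberTheory.QuadraticFields.RingClass
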